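import Literature.AlgebraicGeometry.Resolution.MonoidalTransformStep
import Literature.AlgebraicGeometry.Resolution.DecompositionLayerFrame
import HarnessLib

/-!
# One monoidal transform along the valuation, IN THE FRAME of the reduction `Thm. 1.5 ⇒ Prop. 4.10` ([CoP1] §8)

Topic: `Literature/AlgebraicGeometry/Resolution`. PROOF side of `CossartPiltant2019ReductionP`
(`ArithmeticalThreefoldsLocal.lean`), input (C4): the head of the decomposition layer of
[CoP1] Prop. 9.3 is [CoP1] Prop. 8.1 (`DecompositionLayerStrictParameters.lean`), proved in
print (HAL pp. 22–24) by ITERATING monoidal transforms along the valuation. The single step is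
`MonoidalTransformStep.lean` (for an abstract regular local subring `R ⊆ O`); to iterate it one
must re-establish its hypotheses for the new ring. This file does so in the FRAME (a
universally catenary local domain `S` with `dim S = d`, a field `E` algebraic over `S`, a
valuation ring `O` of `E` dominating `S` with residue field algebraic over that of `S`), for the
local rings `R_t := locAtCentre S[t] O` of MODELS `S[t]` (`t` finite): if `R_t` is regular with
regular system of parameters `x : Fin d → R_t` and `v(x_b/x_a) > 0` (resp. `= 0`), then for
`t₁ := insert (x_b/x_a) t` the ring `R_{t₁}` is the monoidal transform, regular, with the
regular system of parameters and the monomial bookkeeping of `MonoidalTransformStep.lean`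
(`exists_frameStep_of_valuation_lt_one`, `exists_frameStep_of_valuation_eq_one`). The frame
supplies, by name: `dim R_t = d` (`ringKrullDim_locAtCentre_eq_of_frame`, so the `d`
generators form a regular system of parameters), domination and residual algebraicity of `R_t`
(from those of `S`), and `R_{t₁} = locAtCentre (R_t[z]) O` (`locAtCentre_adjoin_locAtCentre_eq`).

Everything is PROVED; no named facts, definitions, instances or notation are introduced.

## Sources

* V. Cossart, O. Piltant, J. Algebra 320 (2008) 1051–1082: proof of Prop. 8.1 and Lemma 8.2
  (HAL hal-00139124, pp. 22–24). [CossartPiltant2008]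
-/

noncomputable section

namespace Literature.AlgebraicGeometry.Resolution

universe u

open IsLocalRing _root_.Polynomial

section FrameStep

variable {S : Type u} [CommRing S] [IsDomain S] [IsLocalRing S] {E : Type u} [Field E]
  [Algebra S E] [Algebra.IsAlgebraic S E]
  (hSuc : IsUniversallyCatenaryRing S) (hinj : Function.Injective (algebraMap S E))
  (O : ValuationSubring E) (hSO : ∀ s : S, algebraMap S E s ∈ O)
  (hdom : ∀ s ∈ maximalIdeal S, O.valuation (algebraMap S E s) < 1)
  (hres : ∀ y : O, ∃ q : S[X], (∃ i, q.coeff i ∉ maximalIdeal S) ∧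
    O.valuation (q.eval₂ (algebraMap S E) y) < 1)

omit [IsDomain S] [IsLocalRing S] [Algebra.IsAlgebraic S E] in
/-- The local ring of a model is dominated by `O`: its maximal ideal is `{v < 1}`, and units
of `S` stay units. [folklore] -/
private theorem dominated_locAtCentre (t : Set E)
    (hTO : (Algebra.adjoin S t).toSubring ≤ O.toSubring) :
    haveI := isLocalRing_locAtCentre hTO
    ∀ r : locAtCentre (Algebra.adjoin S t).toSubring O,
      r ∈ maximalIdeal _ → O.valuation (r : E) < 1 :=
  fun r hr => (mem_maximalIdeal_locAtCentre_iff hTO r).mp hr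

omit [IsDomain S] [Algebra.IsAlgebraic S E] in
include hSO hres in
/-- Residual algebraicity of `O` over the local ring of a model (from that over `S`).
[folklore] -/
private theorem residuallyAlgebraic_locAtCentre (t : Set E)
    (hTO : (Algebra.adjoin S t).toSubring ≤ O.toSubring) :
    haveI := isLocalRing_locAtCentre hTO
    ∀ y : O, ∃ q : (locAtCentre (Algebra.adjoin S t).toSubring O)[X],
      (∃ k, q.coeff k ∉ maximalIdeal _) ∧ O.valuation (aeval (y : E) q) < 1 := by
  haveI := isLocalRing_locAtCentre hTO
  intro y
  obtain ⟨q, ⟨k, hk⟩, hv⟩ := hres y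
  let φ : S →+* locAtCentre (Algebra.adjoin S t).toSubring O :=
    (algebraMap S E).codRestrict _
      (fun s => le_locAtCentre _ _ ((Algebra.adjoin S t).algebraMap_mem s))
  refine ⟨q.map φ, ⟨k, ?_⟩, ?_⟩
  · rw [coeff_map]
    intro hmem
    have hlt := (mem_maximalIdeal_locAtCentre_iff hTO _).mp hmem
    change O.valuation (algebraMap S E (q.coeff k)) < 1 at hlt
    apply hk
    by_contra hnot
    have hu : IsUnit (q.coeff k) := by
      by_contra hnu; exact hnot ((IsLocalRing.mem_maximalIdeal _).mpr hnu)
    obtain ⟨c, hc⟩ := hu.exists_right_inv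
    have h1 : O.valuation (algebraMap S E (q.coeff k)) * O.valuation (algebraMap S E c) = 1 := by
      rw [← map_mul, ← map_mul, hc, map_one, map_one]
    have hle : O.valuation (algebraMap S E c) ≤ 1 := (O.valuation_le_one_iff _).mpr (hSO c)
    have : O.valuation (algebraMap S E (q.coeff k)) * O.valuation (algebraMap S E c) < 1 * 1 :=
      mul_lt_mul_of_lt_of_le_of_nonneg_of_pos hlt hle zero_le zero_lt_one
    rw [h1, one_mul] at this
    exact lt_irrefl _ this
  · have : aeval (y : E) (q.map φ) = q.eval₂ (algebraMap S E) y := by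
      rw [aeval_def, eval₂_map]
      rfl
    rw [this]
    exact hv

set_option maxHeartbeats 800000 in
include hSuc hinj hSO hdom hres in
/-- **One monoidal transform in the frame, case `v(x_b/x_a) > 0`.** For a model `S[t] ⊆ O`
(`t` finite) whose local ring `R_t = locAtCentre S[t] O` is regular with regular system of
parameters `x` (`d = dim S` generators of `𝔪`), indices `a ≠ b` with `v(x_b/x_a) > 0` and
`t₁ := insert (x_b/x_a) t`: `S[t₁] ⊆ O`, `R_{t₁}` is a regular local ring, and there is a
regular system of parameters `x′` of `R_{t₁}` with `x′_c = x_c` (`c ≠ b`), `x′_b = x_b/x_a`,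
generating `𝔪_{R_{t₁}}`, such that `∏ x_c^{α_c} = ∏ x′_c^{α[a ↦ α_a+α_b]_c}` for every `α`.
[cite: CossartPiltant2008, proof of Prop. 8.1 (HAL p. 23)] -/
theorem exists_frameStep_of_valuation_lt_one {d : ℕ} (hSdim : ringKrullDim S = d)
    (t : Set E) (ht : t.Finite) (hTO : (Algebra.adjoin S t).toSubring ≤ O.toSubring)
    (hreg : IsRegularLocalRing (locAtCentre (Algebra.adjoin S t).toSubring O))
    (x : Fin d → locAtCentre (Algebra.adjoin S t).toSubring O)
    (hx : haveI := isLocalRing_locAtCentre hTO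
      Ideal.span (Set.range x) = maximalIdeal _)
    (a b : Fin d) (hab : a ≠ b) (hlt : O.valuation ((x b : E) / (x a : E)) < 1) :
    ∃ (hT₁O : (Algebra.adjoin S (insert ((x b : E) / (x a : E)) t)).toSubring ≤ O.toSubring),
      IsRegularLocalRing
        (locAtCentre (Algebra.adjoin S (insert ((x b : E) / (x a : E)) t)).toSubring O) ∧
      ∃ x' : Fin d → locAtCentre (Algebra.adjoin S (insert ((x b : E) / (x a : E)) t)).toSubring O,
        (∀ c, c ≠ b → (x' c : E) = (x c : E)) ∧ ((x' b : E) = (x b : E) / (x a : E)) ∧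
        (haveI := isLocalRing_locAtCentre hT₁O
         Ideal.span (Set.range x') = maximalIdeal _) ∧
        ∀ α : Fin d → ℕ, (∏ c, (x c : E) ^ α c) =
          ∏ c, (x' c : E) ^ Function.update α a (α a + α b) c := by
  classical
  haveI : IsRegularLocalRing (locAtCentre (Algebra.adjoin S t).toSubring O) := hreg
  haveI : Algebra.FiniteType S (Algebra.adjoin S t) := by
    rw [← ht.coe_toFinset]
    exact (Subalgebra.fg_iff_finiteType _).mp (Subalgebra.fg_adjoin_finset _)
  have hRO : locAtCentre (Algebra.adjoin S t).toSubring O ≤ O.toSubring := locAtCentre_le hTO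
  -- `dim R = d`, hence `x` is a regular system of parameters
  have hdimR : ringKrullDim (locAtCentre (Algebra.adjoin S t).toSubring O) = d := by
    rw [ringKrullDim_locAtCentre_eq_of_frame hSuc hinj O hSO hdom hres (Algebra.adjoin S t) hTO,
      hSdim]
  have hd : (maximalIdeal (locAtCentre (Algebra.adjoin S t).toSubring O)).spanFinrank = d := by
    have h := IsRegularLocalRing.spanFinrank_maximalIdeal
      (R := locAtCentre (Algebra.adjoin S t).toSubring O)
    rw [hdimR] at h
    exact_mod_cast h
  have hdomR := dominated_locAtCentre O t hTO
  have halgR := residuallyAlgebraic_locAtCentre O hSO hres t hTO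
  obtain ⟨hBO, hreg₁, x', hx'c, hx'b, hspan, hmono⟩ :=
    exists_monoidalStep_of_valuation_lt_one (locAtCentre (Algebra.adjoin S t).toSubring O) hd x
      hx O hRO hdomR halgR a b hab hlt
  -- the transform is the local ring of the model `S[insert z t]`
  have hadj : Algebra.adjoin S (((Algebra.adjoin S t : Subalgebra S E) : Set E) ∪
      {(x b : E) / (x a : E)}) = Algebra.adjoin S (insert ((x b : E) / (x a : E)) t) := by
    refine le_antisymm (Algebra.adjoin_le ?_) (Algebra.adjoin_mono ?_)
    · rintro y (hy | hy)
      · exact Algebra.adjoin_mono (Set.subset_insert _ _) hy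
      · rw [Set.mem_singleton_iff] at hy
        subst hy
        exact Algebra.subset_adjoin (Set.mem_insert _ _)
    · rintro y (rfl | hy)
      · exact Or.inr rfl
      · exact Or.inl (Algebra.subset_adjoin hy)
  have hEq : locAtCentre (Algebra.adjoin (locAtCentre (Algebra.adjoin S t).toSubring O)
        {(x b : E) / (x a : E)}).toSubring O =
      locAtCentre (Algebra.adjoin S (insert ((x b : E) / (x a : E)) t)).toSubring O := by
    rw [locAtCentre_adjoin_locAtCentre_eq (Algebra.adjoin S t) O, hadj]
  have hT₁O : (Algebra.adjoin S (insert ((x b : E) / (x a : E)) t)).toSubring ≤ O.toSubring := by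
    refine model_toSubring_le_valuationSubring O hSO (fun y hy => ?_)
    rcases hy with rfl | hy
    · exact (O.valuation_le_one_iff _).mp hlt.le
    · exact hTO (Algebra.subset_adjoin hy)
  refine ⟨hT₁O, by rw [← hEq]; exact hreg₁, ?_⟩
  haveI := isLocalRing_locAtCentre hBO
  haveI := isLocalRing_locAtCentre hT₁O
  -- transport `x′` along the equality of subrings
  let e : locAtCentre (Algebra.adjoin (locAtCentre (Algebra.adjoin S t).toSubring O)
        {(x b : E) / (x a : E)}).toSubring O ≃+*
      locAtCentre (Algebra.adjoin S (insert ((x b : E) / (x a : E)) t)).toSubring O :=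
    { toFun := fun w => ⟨(w : E), hEq ▸ w.2⟩
      invFun := fun w => ⟨(w : E), hEq.symm ▸ w.2⟩
      left_inv := fun _ => rfl
      right_inv := fun _ => rfl
      map_mul' := fun _ _ => rfl
      map_add' := fun _ _ => rfl }
  refine ⟨fun c => e (x' c), fun c hc => hx'c c hc, hx'b, ?_, fun α => hmono α⟩
  have hmap : (Ideal.span (Set.range x')).map e.toRingHom = Ideal.span (Set.range fun c => e (x' c)) := by
    rw [Ideal.map_span, ← Set.range_comp]
    rfl
  rw [← hmap, hspan]
  -- both maximal ideals are `{v < 1}`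
  refine le_antisymm (fun y hy => ?_) (fun y hy => ?_)
  · obtain ⟨w, hw, rfl⟩ := (Ideal.mem_map_iff_of_surjective e.toRingHom e.surjective).mp hy
    rw [mem_maximalIdeal_locAtCentre_iff hT₁O]
    exact (mem_maximalIdeal_locAtCentre_iff hBO w).mp hw
  · have hvy : O.valuation (y : E) < 1 := (mem_maximalIdeal_locAtCentre_iff hT₁O y).mp hy
    have : y = e.toRingHom (e.symm y) := (e.apply_symm_apply y).symm
    rw [this]
    exact Ideal.mem_map_of_mem _ ((mem_maximalIdeal_locAtCentre_iff hBO _).mpr hvy)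

set_option maxHeartbeats 800000 in
include hSuc hinj hSO hdom hres in
/-- **One monoidal transform in the frame, case `v(x_b/x_a) = 0`.** Same setting with
`v(x_b) = v(x_a)`, `z := x_b/x_a`, `t₁ := insert z t`: `S[t₁] ⊆ O`, `R_{t₁}` is a regular
local ring in which `z` is a unit, and there is a family `x′` generating `𝔪_{R_{t₁}}` with
`x′_c = x_c` for `c ≠ b` (and `x′_b = P(z)`), such that
`∏ x_c^{α_c} = z^{α_b} · ∏ x′_c^{α[a ↦ α_a+α_b][b ↦ 0]_c}` for every `α`.
[cite: CossartPiltant2008, proof of Prop. 8.1 (HAL p. 23)] -/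
theorem exists_frameStep_of_valuation_eq_one {d : ℕ} (hSdim : ringKrullDim S = d)
    (t : Set E) (ht : t.Finite) (hTO : (Algebra.adjoin S t).toSubring ≤ O.toSubring)
    (hreg : IsRegularLocalRing (locAtCentre (Algebra.adjoin S t).toSubring O))
    (x : Fin d → locAtCentre (Algebra.adjoin S t).toSubring O)
    (hx : haveI := isLocalRing_locAtCentre hTO
      Ideal.span (Set.range x) = maximalIdeal _)
    (a b : Fin d) (hab : a ≠ b) (h1 : O.valuation ((x b : E) / (x a : E)) = 1) :
    ∃ (hT₁O : (Algebra.adjoin S (insert ((x b : E) / (x a : E)) t)).toSubring ≤ O.toSubring),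
      IsRegularLocalRing
        (locAtCentre (Algebra.adjoin S (insert ((x b : E) / (x a : E)) t)).toSubring O) ∧
      IsUnit (⟨(x b : E) / (x a : E), le_locAtCentre _ _
          (Algebra.subset_adjoin (Set.mem_insert _ _))⟩ :
        locAtCentre (Algebra.adjoin S (insert ((x b : E) / (x a : E)) t)).toSubring O) ∧
      ∃ x' : Fin d → locAtCentre (Algebra.adjoin S (insert ((x b : E) / (x a : E)) t)).toSubring O,
        (∀ c, c ≠ b → (x' c : E) = (x c : E)) ∧
        (haveI := isLocalRing_locAtCentre hT₁O
         Ideal.span (Set.range x') = maximalIdeal _) ∧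
        ∀ α : Fin d → ℕ, (∏ c, (x c : E) ^ α c) =
          ((x b : E) / (x a : E)) ^ α b *
            ∏ c, (x' c : E) ^ Function.update (Function.update α a (α a + α b)) b 0 c := by
  classical
  haveI : IsRegularLocalRing (locAtCentre (Algebra.adjoin S t).toSubring O) := hreg
  haveI : Algebra.FiniteType S (Algebra.adjoin S t) := by
    rw [← ht.coe_toFinset]
    exact (Subalgebra.fg_iff_finiteType _).mp (Subalgebra.fg_adjoin_finset _)
  have hRO : locAtCentre (Algebra.adjoin S t).toSubring O ≤ O.toSubring := locAtCentre_le hTO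
  have hdimR : ringKrullDim (locAtCentre (Algebra.adjoin S t).toSubring O) = d := by
    rw [ringKrullDim_locAtCentre_eq_of_frame hSuc hinj O hSO hdom hres (Algebra.adjoin S t) hTO,
      hSdim]
  have hd : (maximalIdeal (locAtCentre (Algebra.adjoin S t).toSubring O)).spanFinrank = d := by
    have h := IsRegularLocalRing.spanFinrank_maximalIdeal
      (R := locAtCentre (Algebra.adjoin S t).toSubring O)
    rw [hdimR] at h
    exact_mod_cast h
  have hdomR := dominated_locAtCentre O t hTO
  have halgR := residuallyAlgebraic_locAtCentre O hSO hres t hTO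
  obtain ⟨hBO, hreg₁, hunit, x', hx'c, hspan, hmono⟩ :=
    exists_monoidalStep_of_valuation_eq_one (locAtCentre (Algebra.adjoin S t).toSubring O) hd x
      hx O hRO hdomR halgR a b hab h1
  have hadj : Algebra.adjoin S (((Algebra.adjoin S t : Subalgebra S E) : Set E) ∪
      {(x b : E) / (x a : E)}) = Algebra.adjoin S (insert ((x b : E) / (x a : E)) t) := by
    refine le_antisymm (Algebra.adjoin_le ?_) (Algebra.adjoin_mono ?_)
    · rintro y (hy | hy)
      · exact Algebra.adjoin_mono (Set.subset_insert _ _) hy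
      · rw [Set.mem_singleton_iff] at hy
        subst hy
        exact Algebra.subset_adjoin (Set.mem_insert _ _)
    · rintro y (rfl | hy)
      · exact Or.inr rfl
      · exact Or.inl (Algebra.subset_adjoin hy)
  have hEq : locAtCentre (Algebra.adjoin (locAtCentre (Algebra.adjoin S t).toSubring O)
        {(x b : E) / (x a : E)}).toSubring O =
      locAtCentre (Algebra.adjoin S (insert ((x b : E) / (x a : E)) t)).toSubring O := by
    rw [locAtCentre_adjoin_locAtCentre_eq (Algebra.adjoin S t) O, hadj]
  have hT₁O : (Algebra.adjoin S (insert ((x b : E) / (x a : E)) t)).toSubring ≤ O.toSubring := by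
    refine model_toSubring_le_valuationSubring O hSO (fun y hy => ?_)
    rcases hy with rfl | hy
    · exact (O.valuation_le_one_iff _).mp h1.le
    · exact hTO (Algebra.subset_adjoin hy)
  refine ⟨hT₁O, by rw [← hEq]; exact hreg₁, ?_, ?_⟩
  · by_contra hnu
    have := (not_isUnit_locAtCentre_iff hT₁O _).mp hnu
    exact (lt_irrefl _) (h1 ▸ this)
  haveI := isLocalRing_locAtCentre hBO
  haveI := isLocalRing_locAtCentre hT₁O
  let e : locAtCentre (Algebra.adjoin (locAtCentre (Algebra.adjoin S t).toSubring O)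
        {(x b : E) / (x a : E)}).toSubring O ≃+*
      locAtCentre (Algebra.adjoin S (insert ((x b : E) / (x a : E)) t)).toSubring O :=
    { toFun := fun w => ⟨(w : E), hEq ▸ w.2⟩
      invFun := fun w => ⟨(w : E), hEq.symm ▸ w.2⟩
      left_inv := fun _ => rfl
      right_inv := fun _ => rfl
      map_mul' := fun _ _ => rfl
      map_add' := fun _ _ => rfl }
  refine ⟨fun c => e (x' c), fun c hc => hx'c c hc, ?_, fun α => hmono α⟩
  have hmap : (Ideal.span (Set.range x')).map e.toRingHom = Ideal.span (Set.range fun c => e (x' c)) := by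
    rw [Ideal.map_span, ← Set.range_comp]
    rfl
  rw [← hmap, hspan]
  refine le_antisymm (fun y hy => ?_) (fun y hy => ?_)
  · obtain ⟨w, hw, rfl⟩ := (Ideal.mem_map_iff_of_surjective e.toRingHom e.surjective).mp hy
    rw [mem_maximalIdeal_locAtCentre_iff hT₁O]
    exact (mem_maximalIdeal_locAtCentre_iff hBO w).mp hw
  · have hvy : O.valuation (y : E) < 1 := (mem_maximalIdeal_locAtCentre_iff hT₁O y).mp hy
    have : y = e.toRingHom (e.symm y) := (e.apply_symm_apply y).symm
    rw [this]
    exact Ideal.mem_map_of_mem _ ((mem_maximalIdeal_locAtCentre_iff hBO _).mpr hvy)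

end FrameStep

end Literature.AlgebraicGeometry.Resolution

end
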